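import Summits.BirchSwinnertonDyer.Rank1Residual.GaloisImage.SakamotoN11InstanceLevelOneInputs
import Summits.BirchSwinnertonDyer.Rank1Residual.GaloisImage.PropagatedConditionCard
import HarnessLib

/-!
# The level-one N11 instance of Sakamoto 2024 Thm. 4.4 (1) with the located local gap (Lp) GONE:
# `χ(𝓕̄_can) = 1` and `KS₁(E[3], 𝓕_can, 𝒫(τ))` free of rank one from surj(3), the Poitou–Tate family,
# Tate's local Euler–Poincaré characteristic and the [S24] fact — no `hLpIm`, no `hinj`
# (cell `b2b-bsdres`, team n1011, row T-Lp consumer file; seat n1011-p04 gen 5)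

HONEST FRAMING (cell `b2b-bsdres`, run/shared/lean/b2b/bsd-rank1-residual/, verbatim in every
file): the goal of the cell is to DELETE the COMBINATION-SHAPED residual classes of the
Birch–Swinnerton-Dyer formula for ALL analytic-rank `≤ 1` elliptic curves over `ℚ` — "full BSD
formula for every rank `≤ 1` curve in class `C`" assembled STRICTLY from published theorems — so
that the rank-`≤ 1` remainder becomes exactly the CONSTRUCTION-SHAPED classes, which are TYPED
(missing-input `Prop`s), NOT attempted. This is not "finishing BSD". Team n1011 (N10/N11, the
additive block `X4 ∧ p = 3`): research route; no claim beyond the stated classes; the label X4 and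
the mark of RESIDUAL-MAP §I N11 are UNCHANGED by this file; nothing is booked. Theorems only: no
definition, no named fact is minted. CONDITIONAL on the tree's named facts
`Sakamoto2024.kolyvaginSystems_freeRankOne_zmod_three_pow` ([S24] Thm. 4.4 (1), binder `hS24`) and
`localEulerPoincareCharacteristic ℚ_v` (Tate; Milne *ADT* I Thm. 2.8, binder `hEP`), explicit in
the signatures — exactly as n1011-p13's source theorems.

## What

n1011-p13's `hasCoreRank_one_propagatedSelmerStructureOne` (`PropagatedStructureCoreRank`) and the
three level-one theorems of `SakamotoN11InstanceLevelOneInputs` carry the located local gap (Lp)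
`hLpIm : #𝓕̄_3 = 9 · #E(ℚ₃)[3]` (and the injectivity `hinj` of the local invariant maps).  Row T-Lp
(`PropagatedConditionLevels` / `…Count` / `…Card`, this seat) PROVES (Lp) from `hEP` at `ℚ₃` alone
(`natCard_propagatedSelmerStructureOne_three`), and `hinj` is the first clause of `IsPerfect`.  Hence:

* `hasCoreRank_one_propagatedSelmerStructureOne_of_localEuler` — p13's core-rank theorem with
  `hLpIm` replaced by `hEP` at the place above `3`; and
  `hasCoreRank_one_propagatedSelmerStructureOne_of_isPerfect_of_localEuler` — ALL of its local /
  finiteness / duality binders discharged: `χ(𝓕_can) = 1` for every `E/ℚ` at `p = 3` from the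
  Poitou–Tate family (`IsPerfect`, `SumLocalTermEqZero`, `SelmerComplement`) and `hEP` alone;
* `kolyvaginSystems_freeRankOne_levelOne_of_surj_of_localEuler`,
  `exists_tau_kolyvaginSystems_freeRankOne_levelOne_of_surj_of_localEuler`,
  `exists_kolyvaginDatum_kolyvaginSystems_freeRankOne_levelOne_of_surj_of_localEuler` — p13's three
  level-one theorems with `hLpIm` AND `hinj` GONE.  What remains explicit: the fact `hS24`,
  `[Finite E[3]]`, surj(3), (the `τ`-datum in the first), the Poitou–Tate family `inv` with its four
  properties, `hEP` at every finite place, an admissible `S` (and the Kolyvagin datum in the first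
  two) — NO local gap.

References: R. Sakamoto, JTNB 36 (2024) Def. 3.6, Thm. 4.4 [Sakamoto2024]; J. S. Milne, *ADT* I
Thm. 2.8, Thm. 3.2, Lemma 3.3 [MilneADT2006]; R. Greenberg, LNM 1716 (1999) §2; K. Rubin, PCMS 18
(2011) §3.1 [Rubin2011].
-/

noncomputable section

open scoped Classical NumberField ContRepresentation
open Field NumberField IsDedekindDomain
open WeierstrassCurve Literature.NumberTheory.EllipticCurves Literature.NumberTheory.GaloisRepresentations
  Literature.NumberTheory.GaloisRepresentations.DiscreteGaloisModule Literature.NumberTheory.GaloisCohomology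

namespace Summit.BirchSwinnertonDyer.Rank1Residual.GaloisImage

variable (W : WeierstrassCurve ℚ) [W.IsElliptic]

/-! ### The core rank without (Lp) -/

/-- **`χ(𝓕_can) = 1` with the located gap (Lp) DISCHARGED**: n1011-p13's
`hasCoreRank_one_propagatedSelmerStructureOne` with its binder `hLpIm : #𝓕̄_3 = 9 · #E(ℚ₃)[3]`
supplied by `natCard_propagatedSelmerStructureOne_three` from Tate's local Euler–Poincaré
characteristic at the place above `3` (`hEP₃`).  Remaining binders are p13's: the Poitou–Tate family
(`IsPerfect`, `SumLocalTermEqZero`, `SelmerComplement`), `T ⊇ {3} ∪ bad`, `hbd`, `hKfin`, `hKSD`.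
[cite: Sakamoto2024, Def. 3.6 (p. 923) and Thm. 4.4 (p. 926)] [cite: MilneADT2006, Ch. I, Thm. 3.2 and Lemma 3.3] -/
theorem hasCoreRank_one_propagatedSelmerStructureOne_of_localEuler [Finite (geomTorsion W ((3 : ℕ) : ℤ))]
    (inv : LocalInvariants ℚ 3) (hperf : inv.IsPerfect) (hsum : inv.SumLocalTermEqZero)
    (hcompl : inv.SelmerComplement)
    (T : Finset (HeightOneSpectrum (𝓞 ℚ)))
    (h3T : ∀ v : HeightOneSpectrum (𝓞 ℚ), ((3 : ℕ) : 𝓞 ℚ) ∈ v.asIdeal → v ∈ T)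
    (hbadT : ∀ v : HeightOneSpectrum (𝓞 ℚ), ¬ W.HasGoodReductionAt v → v ∈ T)
    (hbd : ∀ v : HeightOneSpectrum (𝓞 ℚ), ((3 : ℕ) : 𝓞 ℚ) ∉ v.asIdeal →
      ∃ N : ℕ, ∀ c : galoisCohomology (W.localGaloisModule
        (Place.Completion (Sum.inr v : Place ℚ))) 1,
        (∃ k : ℕ, ((3 ^ k : ℕ) : ℤ) • c = 0) → ((3 ^ N : ℕ) : ℤ) • c = 0)
    (hKfin : Finite (W.kummerSelmerStructure ((3 : ℕ) : ℤ)).selmerGroup)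
    (hKSD : Nat.card (W.kummerSelmerStructure ((3 : ℕ) : ℤ)).selmerGroup =
      Nat.card (inv.dualSelmerStructure (W.torsionGaloisModule ((3 : ℕ) : ℤ))
        (W.kummerSelmerStructure ((3 : ℕ) : ℤ))).selmerGroup)
    (hEP₃ : ∀ v : HeightOneSpectrum (𝓞 ℚ), ((3 : ℕ) : 𝓞 ℚ) ∈ v.asIdeal →
      localEulerPoincareCharacteristic (v.adicCompletion ℚ)) :
    LocalInvariants.HasCoreRank inv (propagatedSelmerStructureOne W 3) 3 1 :=
  hasCoreRank_one_propagatedSelmerStructureOne W inv hperf hsum hcompl T h3T hbadT hbd hKfin hKSD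
    fun v hv => natCard_propagatedSelmerStructureOne_three W v (hEP₃ v hv) hv

/-- **`χ(𝓕_can) = 1` for EVERY `E/ℚ` at `p = 3` from the Poitou–Tate family and Tate's local
Euler–Poincaré characteristic ALONE** (all of p13's local / finiteness / duality binders discharged:
`hbd` by n1011-p05's `bounded_pPrimaryTorsion_localGaloisModule_rat`, `hKfin` by Silverman X.4.2 (b)
`finite_selmerGroup_holds`, `hKSD` by p13's `natCard_selmerGroup_kummer_eq_dual` on a Weil pairing
(`exists_weilPairing_holds`) with `hinj := (hperf v).1.injective`, and (Lp) by
`natCard_propagatedSelmerStructureOne_three`).  For any finite `T ⊇ {3} ∪ bad`: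
`#H¹_{𝓕̄}(ℚ, E[3]) = 3 · #H¹_{𝓕̄^*}(ℚ, E[3]^D)`, `𝓕̄ = 𝓕_can(E[3])` — Sakamoto's "`χ(𝓕) = 1`".
[cite: Sakamoto2024, Def. 3.6 (p. 923) and Thm. 4.4 (p. 926)] [cite: MilneADT2006, Ch. I, Thm. 2.8, Thm. 3.2 and Lemma 3.3] -/
theorem hasCoreRank_one_propagatedSelmerStructureOne_of_isPerfect_of_localEuler
    [Finite (geomTorsion W ((3 : ℕ) : ℤ))]
    (inv : LocalInvariants ℚ 3) (hperf : inv.IsPerfect) (hsum : inv.SumLocalTermEqZero)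
    (hcompl : inv.SelmerComplement)
    (hEP : ∀ v : HeightOneSpectrum (𝓞 ℚ), localEulerPoincareCharacteristic (v.adicCompletion ℚ))
    (T : Finset (HeightOneSpectrum (𝓞 ℚ)))
    (h3T : ∀ v : HeightOneSpectrum (𝓞 ℚ), ((3 : ℕ) : 𝓞 ℚ) ∈ v.asIdeal → v ∈ T)
    (hbadT : ∀ v : HeightOneSpectrum (𝓞 ℚ), ¬ W.HasGoodReductionAt v → v ∈ T) :
    LocalInvariants.HasCoreRank inv (propagatedSelmerStructureOne W 3) 3 1 := by
  -- `Sel^{(3)}(E/ℚ)` is finite (Silverman X.4.2 (b))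
  have hKfin : Finite (W.kummerSelmerStructure ((3 : ℕ) : ℤ)).selmerGroup := by
    rw [← selmerGroup_eq_selmerGroup_kummerSelmerStructure]
    exact W.finite_selmerGroup_holds (by norm_num)
  -- the residual self-duality count of the `3`-descent structure (Weil pairing on `E[3]`)
  obtain ⟨e, hμ, hadd₁, hadd₂, halt, hnondeg, hgal⟩ :=
    exists_weilPairing_holds W 3 (by norm_num) (by norm_num)
  haveI := hKfin
  have hKSD := natCard_selmerGroup_kummer_eq_dual W 3 e hμ hadd₁ hadd₂ hgal halt hnondeg
    Nat.prime_three.isPrimePow (by decide) inv (fun v => (hperf v).1.injective) hEP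
  exact hasCoreRank_one_propagatedSelmerStructureOne W inv hperf hsum hcompl T h3T hbadT
    (fun v hv => bounded_pPrimaryTorsion_localGaloisModule_rat W 3 hv) hKfin hKSD
    fun v hv => natCard_propagatedSelmerStructureOne_three W v (hEP v) hv

/-! ### Level one with (Lp) and the injectivity discharged -/

/-- **Level one from surj(3), NO local gap**: n1011-p13's
`kolyvaginSystems_freeRankOne_levelOne_of_surj_of_localInputs` with `hLpIm` supplied by
`natCard_propagatedSelmerStructureOne_three W v (hEP v)` and `hinj` by `(hperf v).1.injective`.
`KS₁(E[3], 𝓕_can, 𝒫(τ))` is free of rank one over `𝔽₃` (with the level-wise bijectivity clause)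
given: the fact `hS24`, `[Finite E[3]]`, surj(3), the `τ`-datum, the Poitou–Tate family with its four
properties, `hEP` at every finite place, an admissible `S ⊇ ∞ ∪ {3} ∪ {bad}`, and a Kolyvagin datum
on Sakamoto's primes with the cyclotomic transverse conditions and the canonical comparison maps.
CONDITIONAL on `hS24`; nothing booked; applies on every surj(3) row incl. EXOTIC.
[cite: Sakamoto2024, Def. 3.6 (p. 923), Def. 3.8 (p. 924) and Thm. 4.4 (p. 926)] -/
theorem kolyvaginSystems_freeRankOne_levelOne_of_surj_of_localEuler
    (hS24 : Sakamoto2024.kolyvaginSystems_freeRankOne_zmod_three_pow)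
    [Finite (geomTorsion W ((3 : ℕ) : ℤ))]
    (h3 : W.HasSurjectiveModNGaloisRep ((3 : ℕ) : ℤ))
    (τ : absoluteGaloisGroup ℚ) (hτμ : τ ∈ rootsOfUnityFixer ℚ (3 ^ (0 + 1)))
    (hτq : Nonempty (cokerSubOne (W.torsionGaloisModule (((3 : ℕ) : ℤ) ^ 0 * ((3 : ℕ) : ℤ))) τ ≃+
      ZMod (3 ^ (0 + 1))))
    (inv : LocalInvariants ℚ 3) (hperf : inv.IsPerfect) (hsum : inv.SumLocalTermEqZero)
    (hunro : inv.UnramifiedOrthogonal) (hcompl : inv.SelmerComplement)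
    (hEP : ∀ v : HeightOneSpectrum (𝓞 ℚ), localEulerPoincareCharacteristic (v.adicCompletion ℚ))
    (S : Finset (Place ℚ)) (hS : ∀ w : InfinitePlace ℚ, (Sum.inl w : Place ℚ) ∈ S)
    (h3S : ∀ v : HeightOneSpectrum (𝓞 ℚ), ((3 : ℕ) : 𝓞 ℚ) ∈ v.asIdeal → (Sum.inr v : Place ℚ) ∈ S)
    (hbadS : ∀ v : HeightOneSpectrum (𝓞 ℚ), ¬ W.HasGoodReductionAt v → (Sum.inr v : Place ℚ) ∈ S)
    (D : KolyvaginDatum (W.torsionGaloisModule (((3 : ℕ) : ℤ) ^ 0 * ((3 : ℕ) : ℤ))))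
    (η : (q : HeightOneSpectrum (𝓞 ℚ)) → (ZMod (Ideal.absNorm q.asIdeal))ˣ)
    (hP : D.primes = frobeniusClassPrimes (W.torsionGaloisModule (((3 : ℕ) : ℤ) ^ 0 * ((3 : ℕ) : ℤ)))
      {v | (Sum.inr v : Place ℚ) ∈ S} τ (3 ^ (0 + 1)))
    (hT : D.transverse =
      cyclotomicTransverse (W.torsionGaloisModule (((3 : ℕ) : ℤ) ^ 0 * ((3 : ℕ) : ℤ))))
    (hD : D.HasCanonicalComparison (3 ^ (0 + 1)) η) :
    KolyvaginSystem.IsFreeRankOneZMod (D.kolyvaginSystems (propagatedSelmerStructure W 3 0))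
        (3 ^ (0 + 1)) ∧
      ∀ (d : Finset (HeightOneSpectrum (𝓞 ℚ))) (hd : D.IsLevel d),
        LocalInvariants.lambdaStar inv ((D.atLevel (propagatedSelmerStructure W 3 0) d).induced
          (W.torsionMulBy (((3 : ℕ) : ℤ) ^ 0) ((3 : ℕ) : ℤ))) 3 = 0 →
        Function.Bijective fun κ : D.kolyvaginSystems (propagatedSelmerStructure W 3 0) =>
          (⟨κ.1 d, ((KolyvaginDatum.mem_kolyvaginSystems_iff D _ κ.1).mp κ.2).mem_selmerGroup
              d hd⟩ : (D.atLevel (propagatedSelmerStructure W 3 0) d).selmerGroup) :=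
  kolyvaginSystems_freeRankOne_levelOne_of_surj_of_localInputs W hS24 h3 τ hτμ hτq inv hperf hsum
    hunro hcompl (fun v => (hperf v).1.injective) hEP
    (fun v hv => natCard_propagatedSelmerStructureOne_three W v (hEP v) hv) S hS h3S hbadS D η hP hT hD

/-- **The `τ`-datum discharged existentially, NO local gap**: p13's
`exists_tau_kolyvaginSystems_freeRankOne_levelOne_of_surj_of_localInputs` minus `hLpIm` and `hinj`.
From surj(3) ALONE there IS `τ ∈ Gal(ℚ̄/ℚ(μ₃))` with `E[3]/(τ − 1) ≃ 𝔽₃` such that — given `hS24`,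
the Poitou–Tate family, `hEP` and an admissible `S` — for every Kolyvagin datum on `𝒫(τ)` with the
cyclotomic transverse conditions and the canonical comparison maps, `KS₁(E[3], 𝓕_can, 𝒫(τ))` is free
of rank one over `𝔽₃`.  CONDITIONAL on `hS24`; nothing booked.
[cite: Sakamoto2024, §2 (H.2) (p. 921) and Thm. 4.4 (p. 926)] -/
theorem exists_tau_kolyvaginSystems_freeRankOne_levelOne_of_surj_of_localEuler
    (hS24 : Sakamoto2024.kolyvaginSystems_freeRankOne_zmod_three_pow)
    [Finite (geomTorsion W ((3 : ℕ) : ℤ))]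
    (h3 : W.HasSurjectiveModNGaloisRep ((3 : ℕ) : ℤ))
    (inv : LocalInvariants ℚ 3) (hperf : inv.IsPerfect) (hsum : inv.SumLocalTermEqZero)
    (hunro : inv.UnramifiedOrthogonal) (hcompl : inv.SelmerComplement)
    (hEP : ∀ v : HeightOneSpectrum (𝓞 ℚ), localEulerPoincareCharacteristic (v.adicCompletion ℚ))
    (S : Finset (Place ℚ)) (hS : ∀ w : InfinitePlace ℚ, (Sum.inl w : Place ℚ) ∈ S)
    (h3S : ∀ v : HeightOneSpectrum (𝓞 ℚ), ((3 : ℕ) : 𝓞 ℚ) ∈ v.asIdeal → (Sum.inr v : Place ℚ) ∈ S)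
    (hbadS : ∀ v : HeightOneSpectrum (𝓞 ℚ), ¬ W.HasGoodReductionAt v → (Sum.inr v : Place ℚ) ∈ S) :
    ∃ τ : absoluteGaloisGroup ℚ, τ ∈ rootsOfUnityFixer ℚ (3 ^ (0 + 1)) ∧
      Nonempty (cokerSubOne (W.torsionGaloisModule (((3 : ℕ) : ℤ) ^ 0 * ((3 : ℕ) : ℤ))) τ ≃+
        ZMod (3 ^ (0 + 1))) ∧
      ∀ (D : KolyvaginDatum (W.torsionGaloisModule (((3 : ℕ) : ℤ) ^ 0 * ((3 : ℕ) : ℤ))))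
        (η : (q : HeightOneSpectrum (𝓞 ℚ)) → (ZMod (Ideal.absNorm q.asIdeal))ˣ),
        D.primes = frobeniusClassPrimes (W.torsionGaloisModule (((3 : ℕ) : ℤ) ^ 0 * ((3 : ℕ) : ℤ)))
          {v | (Sum.inr v : Place ℚ) ∈ S} τ (3 ^ (0 + 1)) →
        D.transverse =
          cyclotomicTransverse (W.torsionGaloisModule (((3 : ℕ) : ℤ) ^ 0 * ((3 : ℕ) : ℤ))) →
        D.HasCanonicalComparison (3 ^ (0 + 1)) η →
        KolyvaginSystem.IsFreeRankOneZMod (D.kolyvaginSystems (propagatedSelmerStructure W 3 0))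
            (3 ^ (0 + 1)) ∧
          ∀ (d : Finset (HeightOneSpectrum (𝓞 ℚ))) (hd : D.IsLevel d),
            LocalInvariants.lambdaStar inv ((D.atLevel (propagatedSelmerStructure W 3 0) d).induced
              (W.torsionMulBy (((3 : ℕ) : ℤ) ^ 0) ((3 : ℕ) : ℤ))) 3 = 0 →
            Function.Bijective fun κ : D.kolyvaginSystems (propagatedSelmerStructure W 3 0) =>
              (⟨κ.1 d, ((KolyvaginDatum.mem_kolyvaginSystems_iff D _ κ.1).mp κ.2).mem_selmerGroup
                  d hd⟩ : (D.atLevel (propagatedSelmerStructure W 3 0) d).selmerGroup) :=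
  exists_tau_kolyvaginSystems_freeRankOne_levelOne_of_surj_of_localInputs W hS24 h3 inv hperf hsum
    hunro hcompl (fun v => (hperf v).1.injective) hEP
    (fun v hv => natCard_propagatedSelmerStructureOne_three W v (hEP v) hv) S hS h3S hbadS

/-- **Everything constructible discharged AND no local gap**: p13's
`exists_kolyvaginDatum_kolyvaginSystems_freeRankOne_levelOne_of_surj_of_localInputs` minus `hLpIm`
and `hinj`.  From surj(3) ALONE — given the fact `hS24`, the Poitou–Tate family `inv` (`IsPerfect`,
`SumLocalTermEqZero`, `UnramifiedOrthogonal`, `SelmerComplement`), Tate's local Euler–Poincaré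
characteristic at every finite place and an admissible `S ⊇ ∞ ∪ {3} ∪ {bad}` — THERE ARE `τ`, `η`
and a Kolyvagin datum `D` on Sakamoto's primes `𝒫(τ)` with the cyclotomic transverse conditions and
THE canonical finite–singular comparison maps such that `KS₁(E[3], 𝓕_can, 𝒫(τ))` is free of rank one
over `𝔽₃` (with the level-wise bijectivity clause).  Level one, no tower: every surj(3) row incl.
EXOTIC.  CONDITIONAL on `hS24`; nothing booked; no mark changed.
[cite: Sakamoto2024, §2 (H.2) (p. 921), §4 and Thm. 4.4 (p. 926)] [cite: Rubin2011, Def. 1.9.6 and Def. 2.1.3 (pp. 14, 17)] -/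
theorem exists_kolyvaginDatum_kolyvaginSystems_freeRankOne_levelOne_of_surj_of_localEuler
    (hS24 : Sakamoto2024.kolyvaginSystems_freeRankOne_zmod_three_pow)
    [Finite (geomTorsion W ((3 : ℕ) : ℤ))]
    (h3 : W.HasSurjectiveModNGaloisRep ((3 : ℕ) : ℤ))
    (inv : LocalInvariants ℚ 3) (hperf : inv.IsPerfect) (hsum : inv.SumLocalTermEqZero)
    (hunro : inv.UnramifiedOrthogonal) (hcompl : inv.SelmerComplement)
    (hEP : ∀ v : HeightOneSpectrum (𝓞 ℚ), localEulerPoincareCharacteristic (v.adicCompletion ℚ))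
    (S : Finset (Place ℚ)) (hS : ∀ w : InfinitePlace ℚ, (Sum.inl w : Place ℚ) ∈ S)
    (h3S : ∀ v : HeightOneSpectrum (𝓞 ℚ), ((3 : ℕ) : 𝓞 ℚ) ∈ v.asIdeal → (Sum.inr v : Place ℚ) ∈ S)
    (hbadS : ∀ v : HeightOneSpectrum (𝓞 ℚ), ¬ W.HasGoodReductionAt v → (Sum.inr v : Place ℚ) ∈ S) :
    ∃ (τ : absoluteGaloisGroup ℚ) (η : (q : HeightOneSpectrum (𝓞 ℚ)) → (ZMod (Ideal.absNorm q.asIdeal))ˣ)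
      (D : KolyvaginDatum (W.torsionGaloisModule (((3 : ℕ) : ℤ) ^ 0 * ((3 : ℕ) : ℤ)))),
      τ ∈ rootsOfUnityFixer ℚ (3 ^ (0 + 1)) ∧
      Nonempty (cokerSubOne (W.torsionGaloisModule (((3 : ℕ) : ℤ) ^ 0 * ((3 : ℕ) : ℤ))) τ ≃+
        ZMod (3 ^ (0 + 1))) ∧
      D.primes = frobeniusClassPrimes (W.torsionGaloisModule (((3 : ℕ) : ℤ) ^ 0 * ((3 : ℕ) : ℤ)))
        {v | (Sum.inr v : Place ℚ) ∈ S} τ (3 ^ (0 + 1)) ∧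
      D.transverse =
        cyclotomicTransverse (W.torsionGaloisModule (((3 : ℕ) : ℤ) ^ 0 * ((3 : ℕ) : ℤ))) ∧
      D.HasCanonicalComparison (3 ^ (0 + 1)) η ∧
      (KolyvaginSystem.IsFreeRankOneZMod (D.kolyvaginSystems (propagatedSelmerStructure W 3 0))
          (3 ^ (0 + 1)) ∧
        ∀ (d : Finset (HeightOneSpectrum (𝓞 ℚ))) (hd : D.IsLevel d),
          LocalInvariants.lambdaStar inv ((D.atLevel (propagatedSelmerStructure W 3 0) d).induced
            (W.torsionMulBy (((3 : ℕ) : ℤ) ^ 0) ((3 : ℕ) : ℤ))) 3 = 0 →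
          Function.Bijective fun κ : D.kolyvaginSystems (propagatedSelmerStructure W 3 0) =>
            (⟨κ.1 d, ((KolyvaginDatum.mem_kolyvaginSystems_iff D _ κ.1).mp κ.2).mem_selmerGroup
                d hd⟩ : (D.atLevel (propagatedSelmerStructure W 3 0) d).selmerGroup)) :=
  exists_kolyvaginDatum_kolyvaginSystems_freeRankOne_levelOne_of_surj_of_localInputs W hS24 h3 inv
    hperf hsum hunro hcompl (fun v => (hperf v).1.injective) hEP
    (fun v hv => natCard_propagatedSelmerStructureOne_three W v (hEP v) hv) S hS h3S hbadS

end Summit.BirchSwinnertonDyer.Rank1Residual.GaloisImage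

end
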